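import Mathlib.Algebra.Homology.DerivedCategory.Ext.Linear
import Mathlib.RepresentationTheory.Invariants
import HarnessLib

/-!
# Venture HSemireg — the image of the equivariant `Ext` is the INVARIANTS: the «`p_* = N`-average» naming step
# (PLAN-W1-TW item T-8 (b), image half; w1-tw-1 gen 3)

HONEST FRAMING. Pure homological / linear algebra with Mathlib's `Abelian.Ext`, its `k`-module structure
(`Ext.smul_eq_comp_mk₀`, `Ext.comp_smul`, `Ext.mk₀_smul`, `Ext.comp_sum`, `Ext.mk₀_sum`) and `Representation.invariants`.
No gerbe, no group action on a variety, no sheaf and no semiregularity map is constructed; nothing here says that HC,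
HC_CM or HC_AV holds, and nothing here is a new case of anything. The geometric reading enters ONLY through hypotheses.

## The step being served

The cell's twisted dictionary (seat note `run/shared/lean/pub/pub-hsemireg/widen/W1/TW-EQ-w1tw1.md`, THEOREM TW-EQ (ii);
w1-tw-2's `W1-TW2-FOUNDATIONS.md` §3) reads `Ext_α(E,E) = Ext_{A₁}(N,N)^G` for an `α`-twisted sheaf `E` on an abelian anchor
presented as a `G̃`-equivariant honest sheaf `N` on an isogenous cover (`G` finite, `|G|` invertible). th-4 g6 split the
kernel bookkeeping into (a) a descent equivalence and (b) «`Ext` in the equivariant category `=` the `G`-invariants of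
`Ext` downstairs». Of (b), the tree holds: the INJECTIVITY of `Ext` along the split-unit forgetful functor
(`EquivariantExtEmbedding.lean`, w1-tw-2), the exactness of invariants (`EquivariantInvariantsExact.lean`) and the
kernel law on invariants (`EquivariantSigmaInvariants.lean`). What was named UNTYPED (REPORT-W1-TW §6) is the IMAGE:
«image `=` Fix(`p_*`)» for the idempotent `p = r ≫ η` (unit followed by the averaging retraction) AND the NAMING
«`p_*` `=` the `G`-average, hence Fix(`p_*`) `=` the `G`-invariants». This file types both in the carrier-free shape
they really have, at the level of ONE object `Z` (to be read `Z = R(U(Y)) = ⊕_g g^*Y ≅ Y ⊗ k[G]`, Mackey):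

* data: a `k`-linear abelian category `C`, a finite index type `G` with `|G|` invertible in `k`, morphisms
  `τ_g : Z ⟶ Z` (read: the permutation action of `G` on `⊕_g g^*Y`), `η : Y ⟶ Z` (the unit), `r : Z ⟶ Y` (the average
  `⅟|G| • Σ_g φ_g⁻¹ ∘ pr_g`);
* hypotheses, each used only where stated: `η ≫ τ_g = η` (the unit is invariant), `r ≫ η = ⅟|G| • Σ_g τ_g` (the round
  trip IS the Reynolds average — this is the «`p_* = N`-average» identity, here a hypothesis on three honest morphisms),
  and, for injectivity only, `η ≫ r = 𝟙`.

CONTENT (all PROVED, 0 sorry, no definitions, no named facts), namespace `Summit.Ventures.HSemireg.EquivariantExtAverage`: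
* `hom_forall_comp_eq_iff_exists` — degree `0`, any `k`-linear preadditive category: `f : X ⟶ Z` is `τ`-invariant iff it
  factors through `η`;
* `comp_comp_mk₀_eq` — range ⊆ invariants: `(y ≫ η) ≫ τ_g = y ≫ η` on `Extⁿ(X, ·)`;
* `comp_mk₀_eq_self_of_forall` — **invariants ⊆ Fix(`p_*`)**: a `τ`-invariant `x ∈ Extⁿ(X,Z)` satisfies
  `x ≫ (r ≫ η) = x` (the averaging computation `⅟|G| • Σ_g x ≫ τ_g = ⅟|G| • |G| • x = x`);
* `exists_of_comp_mk₀_eq_self` — Fix(`p_*`) ⊆ range: `x = (x ≫ r) ≫ η`;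
* `exists_iff_forall_comp_mk₀_eq` — **range(`· ≫ η`) `=` the `τ`-invariants of `Extⁿ(X,Z)`**, and
  `forall_comp_mk₀_eq_iff_comp_mk₀_eq_self` — **invariants `=` Fix(`p_*`)**, for every `X`, `n`;
* `comp_mk₀_injective` — `· ≫ η : Extⁿ(X,Y) → Extⁿ(X,Z)` is injective when `η ≫ r = 𝟙`;
* `invariants_eq_range` — the same as an equality of `k`-SUBMODULES for any `Representation k G (Ext X Z n)` acting
  through `τ` (the carrier of `EquivariantSigmaInvariants.lean` / `EquivariantInvariantsExact.lean`):
  `ρ.invariants = range ((mk₀ η).postcompOfLinear k X _)`;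
* `finrank_invariants_eq` — COUNT currency: `dim_k (Extⁿ(X,Z))^G = dim_k Extⁿ(X,Y)` (with the retraction).
So, composed with `EquivariantExtEmbedding.lean`: `Extⁿ_C(X,Y) ≅ (Extⁿ_C(X, R U Y))^G` canonically, and the kernel law
applies to `σ` on the invariants. What remains MODEL-LEVEL (no carrier in the tree for equivariant / twisted sheaves, named
as such): T-8 (a) the descent equivalence `Coh(A₀, α) ≌ Coh^{G̃}(A₁)` for the isogeny, the identification
`Extⁿ_C(X, R U Y) = Extⁿ_{A₁}(U X, U Y)` (derived adjunction of the exact pair `U ⊣ R`, cf. `UntwistDerivedAdjunction.lean`)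
under which `τ_g` becomes conjugation by the linearisations, and the verification of the three displayed identities for
`R U ≅ (·) ⊗ k[G]` (Mackey) — elementary there, hypotheses here.

## References (the printed inputs of the dictionary; nothing below is used in the proofs)

* D. Mumford, *On the equations defining abelian varieties I*, Invent. Math. 1 (1966), §1 (theta groups). [Mumford1966EquationsI]
* R.-O. Buchweitz, H. Flenner, *A semiregularity map for modules and applications to deformations*, Compositio Math. 137
  (2003), §5. [BuchweitzFlenner2003]
* J. P. Pridham, *Semiregularity as a consequence of Goodwillie's theorem*, Forum Math. Sigma 12 (2024), Rem. 2.26. [Pridham2024]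
-/

noncomputable section

open CategoryTheory CategoryTheory.Abelian

namespace Summit.Ventures.HSemireg.EquivariantExtAverage

universe w t v u u'

/-! ### Degree zero: plain morphisms in a `k`-linear preadditive category -/

section Hom

variable {k : Type t} [CommRing k] {C : Type u} [Category.{v} C] [Preadditive C] [Linear k C]
variable {G : Type u'} [Fintype G] {X Y Z : C} (τ : G → (Z ⟶ Z)) (η : Y ⟶ Z) (r : Z ⟶ Y)

/-- **Degree `0`.** In a `k`-linear preadditive category let `τ_g : Z ⟶ Z` (`g ∈ G`, finite, `|G|` invertible in
`k`), `η : Y ⟶ Z` with `η ≫ τ_g = η` for all `g`, and `r : Z ⟶ Y` with `r ≫ η = ⅟|G| • Σ_g τ_g` (the round trip is the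
average). Then a morphism `f : X ⟶ Z` is `τ`-invariant (`f ≫ τ_g = f` for all `g`) iff it factors through `η`.
(Mackey reading: `Hom_C(X, ⊕_g g^*Y)^G = Hom_C(X, Y)`.) [folklore] -/
theorem hom_forall_comp_eq_iff_exists [Invertible (Fintype.card G : k)] (hητ : ∀ g, η ≫ τ g = η)
    (havg : r ≫ η = ⅟(Fintype.card G : k) • ∑ g, τ g) (f : X ⟶ Z) :
    (∀ g, f ≫ τ g = f) ↔ ∃ f' : X ⟶ Y, f' ≫ η = f := by
  constructor
  · intro hf
    refine ⟨f ≫ r, ?_⟩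
    rw [Category.assoc, havg, Linear.comp_smul, Preadditive.comp_sum]
    simp_rw [hf]
    rw [Finset.sum_const, Finset.card_univ, ← Nat.cast_smul_eq_nsmul k, smul_smul, invOf_mul_self',
      one_smul]
  · rintro ⟨f', rfl⟩ g
    rw [Category.assoc, hητ]

end Hom

/-! ### All degrees: Mathlib's `Ext` in a `k`-linear abelian category -/

section Ext

variable {k : Type t} [CommRing k] {C : Type u} [Category.{v} C] [Abelian C] [Linear k C] [HasExt.{w} C]
variable {G : Type u'} [Fintype G] {X Y Z : C} (τ : G → (Z ⟶ Z)) (η : Y ⟶ Z) (r : Z ⟶ Y)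

omit [Fintype G] in
/-- **Range ⊆ invariants.** If the unit is invariant (`η ≫ τ_g = η`), then every class of the form `y ≫ η`,
`y ∈ Extⁿ(X,Y)`, is `τ`-invariant in `Extⁿ(X,Z)` (no finiteness of `G` needed). [folklore] -/
theorem comp_comp_mk₀_eq (hητ : ∀ g, η ≫ τ g = η) {n : ℕ} (y : Ext X Y n) (g : G) :
    (y.comp (Ext.mk₀ η) (add_zero n)).comp (Ext.mk₀ (τ g)) (add_zero n) = y.comp (Ext.mk₀ η) (add_zero n) := by
  rw [Ext.comp_assoc_of_third_deg_zero, Ext.mk₀_comp_mk₀, hητ]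

/-- **Invariants ⊆ Fix(`p_*`) — the «`p_* = N`-average» step.** If `r ≫ η = ⅟|G| • Σ_g τ_g` and `x ∈ Extⁿ(X,Z)` is
`τ`-invariant, then `x ≫ (r ≫ η) = x`: indeed `x ≫ (r ≫ η) = ⅟|G| • Σ_g (x ≫ τ_g) = ⅟|G| • (|G| • x) = x`, using the
`k`-linearity of `Ext.comp` in its second variable. [folklore] -/
theorem comp_mk₀_eq_self_of_forall [Invertible (Fintype.card G : k)]
    (havg : r ≫ η = ⅟(Fintype.card G : k) • ∑ g, τ g) {n : ℕ} (x : Ext X Z n)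
    (hx : ∀ g, x.comp (Ext.mk₀ (τ g)) (add_zero n) = x) :
    x.comp (Ext.mk₀ (r ≫ η)) (add_zero n) = x := by
  rw [havg, Ext.mk₀_smul, Ext.comp_smul, Ext.mk₀_sum, Ext.comp_sum]
  simp_rw [hx]
  rw [Finset.sum_const, Finset.card_univ, ← Nat.cast_smul_eq_nsmul k, smul_smul, invOf_mul_self', one_smul]

/-- **Fix(`p_*`) ⊆ range.** If `x ≫ (r ≫ η) = x` then `x = (x ≫ r) ≫ η` is in the range of `· ≫ η`. (No hypothesis on
`τ` or `|G|`.) [folklore] -/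
theorem exists_of_comp_mk₀_eq_self {n : ℕ} (x : Ext X Z n) (hx : x.comp (Ext.mk₀ (r ≫ η)) (add_zero n) = x) :
    ∃ y : Ext X Y n, y.comp (Ext.mk₀ η) (add_zero n) = x :=
  ⟨x.comp (Ext.mk₀ r) (add_zero n), by rw [Ext.comp_assoc_of_third_deg_zero, Ext.mk₀_comp_mk₀, hx]⟩

/-- **Range(`· ≫ η`) `=` the invariants** (T-8 (b), image half, all degrees). With `η ≫ τ_g = η` for all `g` and
`r ≫ η = ⅟|G| • Σ_g τ_g`: a class `x ∈ Extⁿ(X,Z)` is of the form `y ≫ η` with `y ∈ Extⁿ(X,Y)` iff `x ≫ τ_g = x` for every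
`g ∈ G`. In the cell's reading (`Z = R U Y = ⊕_g g^*Y`, `τ` the permutation action, `η` the unit, `r` the average):
`Extⁿ_{equivariant}(X,Y) ↠ (Extⁿ(X, R U Y))^G`. [folklore] -/
theorem exists_iff_forall_comp_mk₀_eq [Invertible (Fintype.card G : k)] (hητ : ∀ g, η ≫ τ g = η)
    (havg : r ≫ η = ⅟(Fintype.card G : k) • ∑ g, τ g) {n : ℕ} (x : Ext X Z n) :
    (∃ y : Ext X Y n, y.comp (Ext.mk₀ η) (add_zero n) = x) ↔
      ∀ g, x.comp (Ext.mk₀ (τ g)) (add_zero n) = x := by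
  constructor
  · rintro ⟨y, rfl⟩ g
    exact comp_comp_mk₀_eq τ η hητ y g
  · intro hx
    exact exists_of_comp_mk₀_eq_self η r x (comp_mk₀_eq_self_of_forall τ η r havg x hx)

/-- **Invariants `=` Fix(`p_*`)** for the round trip `p = r ≫ η`: under the same two hypotheses, `x ≫ τ_g = x` for all
`g` iff `x ≫ (r ≫ η) = x`. This is the NAMING of the idempotent of `EquivariantExtEmbedding.lean`'s lane («image `=`
Fix(`p_*`)», w1-tw-2) as the Reynolds projector onto the `G`-invariants. [folklore] -/
theorem forall_comp_mk₀_eq_iff_comp_mk₀_eq_self [Invertible (Fintype.card G : k)] (hητ : ∀ g, η ≫ τ g = η)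
    (havg : r ≫ η = ⅟(Fintype.card G : k) • ∑ g, τ g) {n : ℕ} (x : Ext X Z n) :
    (∀ g, x.comp (Ext.mk₀ (τ g)) (add_zero n) = x) ↔ x.comp (Ext.mk₀ (r ≫ η)) (add_zero n) = x := by
  constructor
  · exact comp_mk₀_eq_self_of_forall τ η r havg x
  · intro hx
    obtain ⟨y, rfl⟩ := exists_of_comp_mk₀_eq_self η r x hx
    exact fun g => comp_comp_mk₀_eq τ η hητ y g

/-- **Injectivity from the retraction.** If `η ≫ r = 𝟙 Y` then `y ↦ y ≫ η : Extⁿ(X,Y) → Extⁿ(X,Z)` is injective for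
every `X`, `n` (indeed `y = (y ≫ η) ≫ r`). Together with `exists_iff_forall_comp_mk₀_eq`: `· ≫ η` is a bijection of
`Extⁿ(X,Y)` onto the `τ`-invariants of `Extⁿ(X,Z)`. [folklore] -/
theorem comp_mk₀_injective (hr : η ≫ r = 𝟙 Y) (n : ℕ) :
    Function.Injective (fun y : Ext X Y n => y.comp (Ext.mk₀ η) (add_zero n)) := by
  have key : ∀ y : Ext X Y n, (y.comp (Ext.mk₀ η) (add_zero n)).comp (Ext.mk₀ r) (add_zero n) = y := fun y => by
    rw [Ext.comp_assoc_of_third_deg_zero, Ext.mk₀_comp_mk₀, hr, Ext.comp_mk₀_id]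
  intro y₁ y₂ h
  have h' := congrArg (fun x : Ext X Z n => x.comp (Ext.mk₀ r) (add_zero n)) h
  simpa only [key] using h'

/-- **Submodule form, on the tree's carrier.** For ANY `k`-linear representation `ρ` of a group `G` on `Extⁿ(X,Z)` that
acts through `τ` (`ρ g x = x ≫ τ_g`), under `η ≫ τ_g = η` and `r ≫ η = ⅟|G| • Σ_g τ_g`: the invariants
`ρ.invariants` (Mathlib `Representation.invariants`, the carrier of `EquivariantSigmaInvariants.lean` and
`EquivariantInvariantsExact.lean`) ARE the range of the `k`-linear map `· ≫ η` (Mathlib `Ext.postcompOfLinear`).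
[folklore] -/
theorem invariants_eq_range [Group G] [Invertible (Fintype.card G : k)] (hητ : ∀ g, η ≫ τ g = η)
    (havg : r ≫ η = ⅟(Fintype.card G : k) • ∑ g, τ g) {n : ℕ} (ρ : Representation k G (Ext X Z n))
    (hρ : ∀ (g : G) (x : Ext X Z n), ρ g x = x.comp (Ext.mk₀ (τ g)) (add_zero n)) :
    ρ.invariants = LinearMap.range ((Ext.mk₀ η).postcompOfLinear k X (add_zero n)) := by
  ext x
  rw [Representation.mem_invariants, LinearMap.mem_range]
  simp_rw [hρ]
  rw [← exists_iff_forall_comp_mk₀_eq τ η r hητ havg x]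
  simp only [LinearMap.flip_apply, Ext.bilinearCompOfLinear_apply_apply]

/-- **COUNT currency.** Under the retraction `η ≫ r = 𝟙 Y` in addition: `dim_k (Extⁿ(X,Z))^G = dim_k Extⁿ(X,Y)`
(`Module.finrank`; both sides `0` when infinite-dimensional). In the cell's reading: the dimension of the twisted /
equivariant `Ext` is the dimension of the INVARIANT part of the `Ext` of the cover — the number DETTWIST's `e_k^G`
columns count. [folklore] -/
theorem finrank_invariants_eq [Group G] [Invertible (Fintype.card G : k)] (hr : η ≫ r = 𝟙 Y)
    (hητ : ∀ g, η ≫ τ g = η) (havg : r ≫ η = ⅟(Fintype.card G : k) • ∑ g, τ g) {n : ℕ}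
    (ρ : Representation k G (Ext X Z n))
    (hρ : ∀ (g : G) (x : Ext X Z n), ρ g x = x.comp (Ext.mk₀ (τ g)) (add_zero n)) :
    Module.finrank k ρ.invariants = Module.finrank k (Ext X Y n) := by
  rw [invariants_eq_range τ η r hητ havg ρ hρ]
  apply LinearMap.finrank_range_of_inj
  intro y₁ y₂ h
  apply comp_mk₀_injective η r hr n
  simpa only [LinearMap.flip_apply, Ext.bilinearCompOfLinear_apply_apply] using h

end Ext

end Summit.Ventures.HSemireg.EquivariantExtAverage

end
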